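import Summits.AtomisticToContinuum.Crystallization.Theorems.FreeSplittingCertificatesStrictSplittingRuleLineTrussMajorantSum

/-!
# `StrictSplittingRule` (stmt-AtomisticToContinuum-12560): tail enclosures — the line-truss tension as a finite sum plus a certified remainder

Route `FreeSplittingCertificates`, crux r3 `StrictSplittingRule`, line `registered` (unit b2b-freesplit-B, gen 14); sequel of
`…LineTrussMajorantSum.lean`.  Applying the sharp expansion `h1_tail_asymp_sharp` at the SHIFTED base point `v + Me` encloses the
tension of any bond — near or far — by its first `M` loads (a finite sum, rational at rational `(a,h)` in the scaled frame) plus the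
closed-form leading terms at `v + Me`, with remainder `((14 + 56‖v+Me‖⁻⁶)/32)‖e‖²‖v+Me‖⁻⁸` (`≈ 10⁻⁸‖e‖²` once `‖v+Me‖ ≈ 10`):

* `h1_tail_enclosure` — outgoing line sums from `v` (`⟪v,e⟫ ≥ 0`), any `M : ℕ`;
* `h1_tau_enclosure_out`, `h1_tau_enclosure_in` — the tension `τ c s d` of the landed design (`hV/hF/hτ` style), outgoing resp.
  incoming orientation (the incoming line leaves the root in direction `−y_s`: base point `V c (d − M•s)`).

USE (HOME FAR-LEMMA-SPEC §12): this is the β-enclosure ingredient of a KERNEL model of the near ledger (today the near certificates use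
120-term interval sums with tolerances in python): `β = λ_s τ ∈ λ_s·[S_M − leading − R, S_M − leading + R]` with `S_M` a finite rational
sum.  Structural bookkeeping ([folklore]); VALUE = a kernel-checked brick — NOT a proof of H12⋆, NOT summit progress.
-/

noncomputable section

namespace Summit.AtomisticToContinuum.Crystallization.Theorems.StrictSplittingRuleBirth

open scoped BigOperators Topology
open Filter Set
open Literature.MathematicalPhysics.StatisticalMechanics
open Summit.AtomisticToContinuum.Crystallization.Theorems.PalmUnimodularRigidity.LayeredLawsSelectHcp

/-! ## §8 Tail enclosures: the tension as a finite sum plus a certified remainder (kernel β-enclosures at any bond) -/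

section Enclosure

variable {v e : EuclideanSpace ℝ (Fin 3)}

/-- **Tail enclosure of the outgoing line-truss sum after `M` terms.**  For `v ≠ 0`, `e ≠ 0`, `⟪v,e⟫ ≥ 0` and every `M : ℕ`, with
`v_M = v + M e`:
`|Σ_{m≥1} F(m) − (Σ_{m=1}^{M} F(m) − ½V_LJ(‖v_M‖) − ½W′(‖v_M‖²)⟪v_M, e⟫)| ≤ ((14 + 56‖v_M‖⁻⁶)/32)·‖e‖²·‖v_M‖⁻⁸`
(`h1_tail_asymp_sharp` applied at the shifted base point `v_M`; the first `M` loads are kept exactly).  With `M` such that `‖v_M‖ ≈ 10`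
the remainder is `≈ 10⁻⁸·‖e‖²`: a finite rational sum encloses the readout coefficient `β = λ_s τ` of ANY bond, near or far — the
β-enclosure ingredient of a kernel model of the near ledger (HOME FAR-LEMMA-SPEC §12). [folklore] -/
theorem h1_tail_enclosure (hv : 0 < ‖v‖) (he : 0 < ‖e‖) (hve : 0 ≤ inner ℝ v e) (M : ℕ) :
    |∑' m : ℕ, ljSqDeriv (‖v + ((m : ℝ) + 1) • e‖ ^ 2) * inner ℝ (v + ((m : ℝ) + 1) • e) e -
        (∑ m ∈ Finset.range M, ljSqDeriv (‖v + ((m : ℝ) + 1) • e‖ ^ 2) * inner ℝ (v + ((m : ℝ) + 1) • e) e -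
          1 / 2 * lennardJones ‖v + (M : ℝ) • e‖ -
            1 / 2 * (ljSqDeriv (‖v + (M : ℝ) • e‖ ^ 2) * inner ℝ (v + (M : ℝ) • e) e))| ≤
      (14 + 56 * (‖v + (M : ℝ) • e‖⁻¹) ^ 6) / 32 * (‖e‖ ^ 2 * (‖v + (M : ℝ) • e‖⁻¹) ^ 8) := by
  set F : ℝ → ℝ := fun t => ljSqDeriv (‖v + t • e‖ ^ 2) * inner ℝ (v + t • e) e with hF
  set w := v + (M : ℝ) • e with hw
  have hM : (0 : ℝ) ≤ M := Nat.cast_nonneg M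
  -- the shifted base point is again outgoing and nonzero
  have hw2 : ‖v‖ ^ 2 ≤ ‖w‖ ^ 2 := le_trans (by nlinarith) (h1_line_norm_sq_ge hve hM).1
  have hwn : ‖v‖ ≤ ‖w‖ := (pow_le_pow_iff_left₀ (norm_nonneg _) (norm_nonneg _) two_ne_zero).mp hw2
  have hwpos : 0 < ‖w‖ := hv.trans_le hwn
  have hwe : 0 ≤ inner ℝ w e := by rw [hw, h1_line_inner]; positivity
  -- summability and splitting of the series after `M` terms
  set ρ₀ := min ‖v‖ ‖e‖ with hρ₀
  have hρ : 0 < ρ₀ := lt_min hv he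
  have hFsum : Summable fun m : ℕ => F ((m : ℝ) + 1) := (h1_master hρ (min_le_left _ _) (min_le_right _ _) hve).1
  have hsplit := (hFsum.sum_add_tsum_nat_add M).symm
  -- the shifted terms are the loads of the line from `w`
  have hshift : ∀ m : ℕ, F ((((m + M : ℕ) : ℝ)) + 1) = ljSqDeriv (‖w + ((m : ℝ) + 1) • e‖ ^ 2) * inner ℝ (w + ((m : ℝ) + 1) • e) e := by
    intro m
    have e1 : v + ((((m + M : ℕ) : ℝ)) + 1) • e = w + ((m : ℝ) + 1) • e := by
      rw [hw, add_assoc, ← add_smul]; congr 1; push_cast; ring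
    show ljSqDeriv (‖v + ((((m + M : ℕ) : ℝ)) + 1) • e‖ ^ 2) * inner ℝ (v + ((((m + M : ℕ) : ℝ)) + 1) • e) e = _
    rw [e1]
  have htail : ∑' m : ℕ, F ((((m + M : ℕ) : ℝ)) + 1) =
      ∑' m : ℕ, ljSqDeriv (‖w + ((m : ℝ) + 1) • e‖ ^ 2) * inner ℝ (w + ((m : ℝ) + 1) • e) e := tsum_congr hshift
  have hsharp := h1_tail_asymp_sharp hwpos he hwe
  -- assemble
  show |∑' m : ℕ, F ((m : ℝ) + 1) - (∑ m ∈ Finset.range M, F ((m : ℝ) + 1) - 1 / 2 * lennardJones ‖w‖ -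
      1 / 2 * (ljSqDeriv (‖w‖ ^ 2) * inner ℝ w e))| ≤ (14 + 56 * (‖w‖⁻¹) ^ 6) / 32 * (‖e‖ ^ 2 * (‖w‖⁻¹) ^ 8)
  have e1 : ∑' m : ℕ, F ((m : ℝ) + 1) - (∑ m ∈ Finset.range M, F ((m : ℝ) + 1) - 1 / 2 * lennardJones ‖w‖ -
      1 / 2 * (ljSqDeriv (‖w‖ ^ 2) * inner ℝ w e)) =
      ∑' m : ℕ, ljSqDeriv (‖w + ((m : ℝ) + 1) • e‖ ^ 2) * inner ℝ (w + ((m : ℝ) + 1) • e) e +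
        1 / 2 * lennardJones ‖w‖ + 1 / 2 * (ljSqDeriv (‖w‖ ^ 2) * inner ℝ w e) := by
    rw [hsplit, ← htail]
    have : (fun i : ℕ => F ((i : ℝ) + 1)) = fun i : ℕ => F ((i : ℝ) + 1) := rfl
    push_cast
    ring
  rw [e1]
  exact hsharp

end Enclosure

section EnclosureTau

variable {a h : ℝ} {V : Bool → ℤ × ℤ × ℤ → EuclideanSpace ℝ (Fin 3)} {F : Bool → (ℤ × ℤ × ℤ) → (ℤ × ℤ × ℤ) → ℤ → ℝ}
  {τ : Bool → (ℤ × ℤ × ℤ) → (ℤ × ℤ × ℤ) → ℝ}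

/-- **Tension enclosure, outgoing bonds.**  If `⟪V c d, y_s⟫ ≥ 0` then for every `M : ℕ`, with `w = V c (d + M•s)`:
`|τ c s d − (Σ_{n=1}^{M} F c s d n − ½V_LJ(‖w‖) − ½W′(‖w‖²)⟪w, y_s⟫)| ≤ ((14 + 56‖w‖⁻⁶)/32)‖y_s‖²‖w‖⁻⁸`. [folklore] -/
theorem h1_tau_enclosure_out (ha : 0 < a) (hh : 0 < h)
    (hV : ∀ c d, V c d = if c = true then hcpSite a h d else -hcpSite a h (-d))
    (hF : ∀ c s d n, F c s d n =
      ljSqDeriv (‖V c (d + n • s)‖ ^ 2) * inner ℝ (V c (d + n • s)) (hcpSite a h s))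
    (hτ : ∀ c s d, τ c s d = if 0 ≤ inner ℝ (V c d) (hcpSite a h s) then ∑' m : ℕ, F c s d ((m : ℤ) + 1)
      else -(F c s d 0 + ∑' m : ℕ, F c s d (-((m : ℤ) + 1))))
    (c : Bool) {s : ℤ × ℤ × ℤ} (hs : s ∈ ({(0, 1, 0), (0, 0, 1), (0, -1, 1), (2, 0, 0)} : Finset (ℤ × ℤ × ℤ)))
    {d : ℤ × ℤ × ℤ} (hd : d ≠ 0) (hsg : 0 ≤ inner ℝ (V c d) (hcpSite a h s)) (M : ℕ) :
    |τ c s d - (∑ n ∈ Finset.range M, F c s d ((n : ℤ) + 1) - 1 / 2 * lennardJones ‖V c (d + (M : ℤ) • s)‖ -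
        1 / 2 * (ljSqDeriv (‖V c (d + (M : ℤ) • s)‖ ^ 2) * inner ℝ (V c (d + (M : ℤ) • s)) (hcpSite a h s)))| ≤
      (14 + 56 * (‖V c (d + (M : ℤ) • s)‖⁻¹) ^ 6) / 32 *
        (‖hcpSite a h s‖ ^ 2 * (‖V c (d + (M : ℤ) • s)‖⁻¹) ^ 8) := by
  set ρ₀ := min a h with hρ₀
  set e := hcpSite a h s with he_def
  set v := V c d with hv_def
  have hρ : 0 < ρ₀ := lt_min ha hh
  have hs0 : s ≠ 0 := by rintro rfl; exact absurd hs (by decide)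
  have hepos : 0 < ‖e‖ := hρ.trans_le (h1_norm_ge ha hh hs0)
  have hvpos : 0 < ‖v‖ := hρ.trans_le (h1_V_norm_ge ha hh hV c hd)
  have hline : ∀ n : ℤ, V c (d + n • s) = v + (n : ℝ) • e := h1_V_line hV c (h1_stencil_even hs) d
  have hFn : ∀ n : ℤ, F c s d n = ljSqDeriv (‖v + (n : ℝ) • e‖ ^ 2) * inner ℝ (v + (n : ℝ) • e) e := fun n => by
    rw [hF, hline]
  have hM : V c (d + (M : ℤ) • s) = v + (M : ℝ) • e := by rw [hline]; norm_cast
  rw [hτ, if_pos hsg, hM]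
  have hcongr : ∑' m : ℕ, F c s d ((m : ℤ) + 1) =
      ∑' m : ℕ, ljSqDeriv (‖v + ((m : ℝ) + 1) • e‖ ^ 2) * inner ℝ (v + ((m : ℝ) + 1) • e) e :=
    tsum_congr fun m => by rw [hFn]; push_cast; rfl
  have hcongr2 : ∑ n ∈ Finset.range M, F c s d ((n : ℤ) + 1) =
      ∑ m ∈ Finset.range M, ljSqDeriv (‖v + ((m : ℝ) + 1) • e‖ ^ 2) * inner ℝ (v + ((m : ℝ) + 1) • e) e :=
    Finset.sum_congr rfl fun m _ => by rw [hFn]; push_cast; rfl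
  rw [hcongr, hcongr2]
  exact h1_tail_enclosure hvpos hepos hsg M

/-- **Tension enclosure, incoming bonds.**  If `⟪V c d, y_s⟫ < 0` then for every `M : ℕ`, with `w = V c (d − M•s)` (the line followed
AWAY from the root):
`|τ c s d − (−F c s d 0 − Σ_{n=1}^{M} F c s d (−n) − ½V_LJ(‖w‖) + ½W′(‖w‖²)⟪w, y_s⟫)| ≤ ((14 + 56‖w‖⁻⁶)/32)‖y_s‖²‖w‖⁻⁸`
(the first-order term is `−½W′(‖w‖²)⟪w, −y_s⟫`: the line leaves the root in direction `−y_s`). [folklore] -/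
theorem h1_tau_enclosure_in (ha : 0 < a) (hh : 0 < h)
    (hV : ∀ c d, V c d = if c = true then hcpSite a h d else -hcpSite a h (-d))
    (hF : ∀ c s d n, F c s d n =
      ljSqDeriv (‖V c (d + n • s)‖ ^ 2) * inner ℝ (V c (d + n • s)) (hcpSite a h s))
    (hτ : ∀ c s d, τ c s d = if 0 ≤ inner ℝ (V c d) (hcpSite a h s) then ∑' m : ℕ, F c s d ((m : ℤ) + 1)
      else -(F c s d 0 + ∑' m : ℕ, F c s d (-((m : ℤ) + 1))))
    (c : Bool) {s : ℤ × ℤ × ℤ} (hs : s ∈ ({(0, 1, 0), (0, 0, 1), (0, -1, 1), (2, 0, 0)} : Finset (ℤ × ℤ × ℤ)))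
    {d : ℤ × ℤ × ℤ} (hd : d ≠ 0) (hsg : inner ℝ (V c d) (hcpSite a h s) < 0) (M : ℕ) :
    |τ c s d - (-F c s d 0 - ∑ n ∈ Finset.range M, F c s d (-((n : ℤ) + 1)) -
        1 / 2 * lennardJones ‖V c (d - (M : ℤ) • s)‖ +
          1 / 2 * (ljSqDeriv (‖V c (d - (M : ℤ) • s)‖ ^ 2) * inner ℝ (V c (d - (M : ℤ) • s)) (hcpSite a h s)))| ≤
      (14 + 56 * (‖V c (d - (M : ℤ) • s)‖⁻¹) ^ 6) / 32 *
        (‖hcpSite a h s‖ ^ 2 * (‖V c (d - (M : ℤ) • s)‖⁻¹) ^ 8) := by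
  set ρ₀ := min a h with hρ₀
  set e := hcpSite a h s with he_def
  set v := V c d with hv_def
  have hρ : 0 < ρ₀ := lt_min ha hh
  have hs0 : s ≠ 0 := by rintro rfl; exact absurd hs (by decide)
  have hepos : 0 < ‖e‖ := hρ.trans_le (h1_norm_ge ha hh hs0)
  have hepos' : 0 < ‖-e‖ := by rwa [norm_neg]
  have hvpos : 0 < ‖v‖ := hρ.trans_le (h1_V_norm_ge ha hh hV c hd)
  have hve' : 0 ≤ inner ℝ v (-e) := by rw [inner_neg_right]; linarith
  have hline : ∀ n : ℤ, V c (d + n • s) = v + (n : ℝ) • e := h1_V_line hV c (h1_stencil_even hs) d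
  have hFn : ∀ n : ℤ, F c s d n = ljSqDeriv (‖v + (n : ℝ) • e‖ ^ 2) * inner ℝ (v + (n : ℝ) • e) e := fun n => by
    rw [hF, hline]
  have hM : V c (d - (M : ℤ) • s) = v + (M : ℝ) • (-e) := by
    rw [show d - (M : ℤ) • s = d + (-(M : ℤ)) • s by rw [neg_smul, sub_eq_add_neg], hline]
    push_cast
    rw [smul_neg, neg_smul]
  rw [hτ, if_neg (not_le.mpr hsg), hM]
  have hG : ∀ m : ℕ, F c s d (-((m : ℤ) + 1)) =
      -(ljSqDeriv (‖v + ((m : ℝ) + 1) • (-e)‖ ^ 2) * inner ℝ (v + ((m : ℝ) + 1) • (-e)) (-e)) := by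
    intro m
    rw [hFn, inner_neg_right]
    push_cast
    rw [show v + (-((m : ℝ) + 1)) • e = v + ((m : ℝ) + 1) • (-e) by rw [smul_neg, neg_smul]]
    ring
  have hsumG : ∑' m : ℕ, F c s d (-((m : ℤ) + 1)) =
      -∑' m : ℕ, ljSqDeriv (‖v + ((m : ℝ) + 1) • (-e)‖ ^ 2) * inner ℝ (v + ((m : ℝ) + 1) • (-e)) (-e) := by
    rw [← tsum_neg]; exact tsum_congr hG
  have hsumG2 : ∑ n ∈ Finset.range M, F c s d (-((n : ℤ) + 1)) =
      -∑ m ∈ Finset.range M, ljSqDeriv (‖v + ((m : ℝ) + 1) • (-e)‖ ^ 2) * inner ℝ (v + ((m : ℝ) + 1) • (-e)) (-e) := by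
    rw [← Finset.sum_neg_distrib]; exact Finset.sum_congr rfl fun m _ => hG m
  have henc := h1_tail_enclosure hvpos hepos' hve' M
  rw [norm_neg, inner_neg_right] at henc
  rw [hsumG, hsumG2]
  have e2 : -(F c s d 0 + -∑' m : ℕ, ljSqDeriv (‖v + ((m : ℝ) + 1) • -e‖ ^ 2) * inner ℝ (v + ((m : ℝ) + 1) • -e) (-e)) -
      (-F c s d 0 - -∑ m ∈ Finset.range M, ljSqDeriv (‖v + ((m : ℝ) + 1) • -e‖ ^ 2) * inner ℝ (v + ((m : ℝ) + 1) • -e) (-e) -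
        1 / 2 * lennardJones ‖v + (M : ℝ) • -e‖ +
          1 / 2 * (ljSqDeriv (‖v + (M : ℝ) • -e‖ ^ 2) * inner ℝ (v + (M : ℝ) • -e) e)) =
      ∑' m : ℕ, ljSqDeriv (‖v + ((m : ℝ) + 1) • -e‖ ^ 2) * inner ℝ (v + ((m : ℝ) + 1) • -e) (-e) -
        (∑ m ∈ Finset.range M, ljSqDeriv (‖v + ((m : ℝ) + 1) • -e‖ ^ 2) * inner ℝ (v + ((m : ℝ) + 1) • -e) (-e) -
          1 / 2 * lennardJones ‖v + (M : ℝ) • -e‖ -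
            1 / 2 * (ljSqDeriv (‖v + (M : ℝ) • -e‖ ^ 2) * -inner ℝ (v + (M : ℝ) • -e) e)) := by ring
  rw [e2]
  exact henc

end EnclosureTau

end Summit.AtomisticToContinuum.Crystallization.Theorems.StrictSplittingRuleBirth

end
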